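import Summits.KontsevichZagierPeriods.KontsevichZagierPeriods.Theorems.RealEllipticSectorKernel.Negative.Core
import Literature.NumberTheory.Transcendental.KZSemialgebraicComplex
import Literature.NumberTheory.Transcendental.SemialgebraicMapsProofs
import Literature.NumberTheory.Transcendental.EllIterRep
import Mathlib.Analysis.Calculus.Deriv.Inv
import Mathlib.Analysis.Calculus.FDeriv.Prod
import Mathlib.Topology.Algebra.Module.Determinant

/-!
# `RealEllipticSectorKernel` (stmt-KontsevichZagierPeriods-10632, route HermiteRigidity) — line
`oval-hermite-engine`, stub `stub_twoTorsion`

The unbounded component `σ'' = (e₁, ∞)` of the real elliptic sector of a rational Weierstrass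
cubic `f = 4x³ − q₂x − q₃ = 4(x − e₁)(x − e₂)(x − e₃)` (`e₃ < e₂ < e₁` real algebraic) is disposed
of by ONE change-of-variables move of the Kontsevich–Zagier calculus (`KZ.changeOfVariablesRel`,
printed rule 2): the translation by the `2`-torsion point `(e₂, 0)` of `y² = f(x)`, read on
`x`-coordinates,
`Φ(x) = e₂ + a/(x − e₂)`, `a = (e₂ − e₁)(e₂ − e₃) < 0`,
is an increasing bijection `(e₁, ∞) → (e₃, e₂)` (`Φ(e₁⁺) = e₃`, `Φ(∞) = e₂`, `Φ ∘ Φ = id`) with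
`f(Φ x) = Φ′(x)² f(x)`, `Φ′(x) = −a/(x − e₂)²`, so that the Jacobian weight `|Φ′(x)|/√f(Φ x)` is
exactly `1/√f(x)`. Hence `[(e₁,∞), 1/√f] − [(e₃,e₂), 1/√f] ∈ KZ.relations` for ARBITRARY
representations with these domains and integrands equal to `1/√f` on them.

The map `Φ` is `ℚ`-semialgebraic on `(e₁, ∞)` although `e₂, a ∉ ℚ` in general: real algebraic
constants are `ℚ`-semialgebraic functions (`isSemialgebraicFunOn_const_of_isAlgebraic`) and
`ℚ`-semialgebraic functions are closed under `+, −, /` (Tarski–Seidenberg,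
`IsSemialgebraicFunOn.add_holds/sub_holds/div`).

References: M. Kontsevich, D. Zagier, *Periods* (2001), §1.2 rule (2); E. T. Whittaker,
G. N. Watson, *A Course of Modern Analysis* (1927), §20.33 (addition of a half-period,
`℘(z + ω₂) = e₂ + (e₂ − e₁)(e₂ − e₃)/(℘(z) − e₂)`).
-/

noncomputable section

open MeasureTheory Set

namespace Summit.KontsevichZagierPeriods.HermiteRigidity.RealEllipticSectorKernel

open Literature.NumberTheory.Transcendental Literature.ModelTheory.ExponentialFields
open Summit.KontsevichZagierPeriods.RealEllipticSectorKernel.Negative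

/-! ### The translation `Φ(x) = e₂ + a/(x − e₂)` on `ℝ¹`: derivative, determinant, injectivity -/

/-- The self-map `p ↦ (e₂ + a/(p 0 − e₂))` of `ℝ¹` has Fréchet derivative `(−a/(p 0 − e₂)²) • id`
at every `p` with `p 0 ≠ e₂` (the scalar derivative of `y ↦ e₂ + a/(y − e₂)` is `−a/(y − e₂)²`).
[folklore] -/
theorem twoTorsion_hasFDerivAt (a e₂ : ℝ) {p : Fin 1 → ℝ} (hp : p 0 ≠ e₂) :
    HasFDerivAt (fun q : Fin 1 → ℝ => fun _ : Fin 1 => e₂ + a / (q 0 - e₂))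
      ((-a / (p 0 - e₂) ^ 2) • ContinuousLinearMap.id ℝ (Fin 1 → ℝ)) p := by
  -- scalar derivative, adapted from `TwoTorsionTransfer.hasDerivAt_phi`
  -- (Theorems/HermiteRigidityTwoTorsionTransferMove)
  have hsc : HasDerivAt (fun y : ℝ => e₂ + a / (y - e₂)) (-a / (p 0 - e₂) ^ 2) (p 0) := by
    have h0 : p 0 - e₂ ≠ 0 := sub_ne_zero.mpr hp
    have h1 : HasDerivAt (fun y : ℝ => y - e₂) 1 (p 0) := (hasDerivAt_id (p 0)).sub_const e₂
    have h2 : HasDerivAt (fun y : ℝ => (y - e₂)⁻¹) (-(1 : ℝ) / (p 0 - e₂) ^ 2) (p 0) := h1.inv h0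
    have h3 : HasDerivAt (fun y : ℝ => e₂ + a * (y - e₂)⁻¹) (a * (-(1 : ℝ) / (p 0 - e₂) ^ 2))
        (p 0) :=
      (h2.const_mul a).const_add e₂
    have h4 : (fun y : ℝ => e₂ + a / (y - e₂)) = fun y => e₂ + a * (y - e₂)⁻¹ := by
      funext y
      rw [div_eq_mul_inv]
    rw [h4]
    exact h3.congr_deriv (by ring)
  -- assembling the `ℝ¹`-map, adapted from `TwoTorsionElement.hasFDerivAt_invMap`
  -- (Theorems/RealEllipticSectorKernel/Negative/TwoTorsionElement)
  have h1 : HasFDerivAt (fun q : Fin 1 → ℝ => q 0) (ContinuousLinearMap.proj 0) p :=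
    hasFDerivAt_apply (𝕜 := ℝ) 0 p
  have h2 := hsc.comp_hasFDerivAt p h1
  rw [hasFDerivAt_pi']
  intro i
  have h3 : (ContinuousLinearMap.proj i).comp
      ((-a / (p 0 - e₂) ^ 2) • ContinuousLinearMap.id ℝ (Fin 1 → ℝ)) =
      (-a / (p 0 - e₂) ^ 2) • ContinuousLinearMap.proj (R := ℝ) (φ := fun _ : Fin 1 => ℝ) 0 := by
    ext v
    simp [Fin.fin_one_eq_zero i]
  rw [h3]
  exact h2

/-- On `ℝ¹`, `det (d • id) = d`. [folklore] -/
theorem twoTorsion_det (d : ℝ) :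
    ((d • ContinuousLinearMap.id ℝ (Fin 1 → ℝ) : (Fin 1 → ℝ) →L[ℝ] (Fin 1 → ℝ))).det = d := by
  -- adapted from `TwoTorsionElement.det_invMapDeriv` (Negative/TwoTorsionElement)
  have h1 : ((d • ContinuousLinearMap.id ℝ (Fin 1 → ℝ) : (Fin 1 → ℝ) →L[ℝ] (Fin 1 → ℝ)) :
      (Fin 1 → ℝ) →ₗ[ℝ] (Fin 1 → ℝ)) = d • LinearMap.id := by
    ext x i
    simp
  unfold ContinuousLinearMap.det
  rw [h1, LinearMap.det_smul, LinearMap.det_id, Module.finrank_fin_fun]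
  simp

/-- For `a ≠ 0` the map `p ↦ (e₂ + a/(p 0 − e₂))` is injective on every set avoiding the pole
`{p 0 = e₂}`. [folklore] -/
theorem twoTorsion_injOn {a e₂ : ℝ} (ha : a ≠ 0) {s : Set (Fin 1 → ℝ)}
    (hs : ∀ p ∈ s, p 0 ≠ e₂) :
    InjOn (fun q : Fin 1 → ℝ => fun _ : Fin 1 => e₂ + a / (q 0 - e₂)) s := by
  intro p hp q hq h
  have h0 : e₂ + a / (p 0 - e₂) = e₂ + a / (q 0 - e₂) := congr_fun h 0
  have hp0 : p 0 - e₂ ≠ 0 := sub_ne_zero.mpr (hs p hp)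
  have hq0 : q 0 - e₂ ≠ 0 := sub_ne_zero.mpr (hs q hq)
  have h1 : a / (p 0 - e₂) = a / (q 0 - e₂) := add_left_cancel h0
  rw [div_eq_div_iff hp0 hq0] at h1
  have h2 : q 0 - e₂ = p 0 - e₂ := mul_left_cancel₀ ha h1
  funext i
  rw [Fin.fin_one_eq_zero i]
  linarith

/-! ### With `a = (e₂ − e₁)(e₂ − e₃)`: `Φ` maps `(e₁, ∞)` onto `(e₃, e₂)` and preserves `dx/√f` -/

variable {e₁ e₂ e₃ : ℝ}

/-- For `x > e₁` the translate `Φ(x)` lies in the oval `(e₃, e₂)`: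
`Φ(x) − e₃ = (e₂ − e₃)(x − e₁)/(x − e₂) > 0` and `Φ(x) − e₂ = a/(x − e₂) < 0`. [folklore] -/
theorem twoTorsion_mem (h₃₂ : e₃ < e₂) (h₂₁ : e₂ < e₁) {x : ℝ} (hx : e₁ < x) :
    e₃ < e₂ + (e₂ - e₁) * (e₂ - e₃) / (x - e₂) ∧ e₂ + (e₂ - e₁) * (e₂ - e₃) / (x - e₂) < e₂ := by
  -- adapted from `TwoTorsionTransfer.phi_mem_Ioo` (Theorems/HermiteRigidityTwoTorsionTransferMove)
  have hx2 : 0 < x - e₂ := by linarith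
  have ha : (e₂ - e₁) * (e₂ - e₃) < 0 := mul_neg_of_neg_of_pos (by linarith) (by linarith)
  constructor
  · have : e₂ + (e₂ - e₁) * (e₂ - e₃) / (x - e₂) - e₃ = (e₂ - e₃) * (x - e₁) / (x - e₂) := by
      field_simp
      ring
    have hpos : 0 < (e₂ - e₃) * (x - e₁) / (x - e₂) :=
      div_pos (mul_pos (by linarith) (by linarith)) hx2
    linarith
  · have : (e₂ - e₁) * (e₂ - e₃) / (x - e₂) < 0 := div_neg_of_neg_of_pos ha hx2
    linarith

/-- For `e₃ < y < e₂` one has `e₁ < Φ(y)` (`Φ(y) − e₁ = (e₂ − e₁)(y − e₃)/(y − e₂) > 0`), so that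
`y = Φ(Φ(y))` is hit from `(e₁, ∞)`. [folklore] -/
theorem twoTorsion_lt (h₂₁ : e₂ < e₁) {y : ℝ} (hy₃ : e₃ < y) (hy₂ : y < e₂) :
    e₁ < e₂ + (e₂ - e₁) * (e₂ - e₃) / (y - e₂) := by
  -- adapted from `TwoTorsionTransfer.lt_phi_of_mem_Ioo`
  -- (Theorems/HermiteRigidityTwoTorsionTransferMove)
  have hy2 : y - e₂ < 0 := by linarith
  have : e₂ + (e₂ - e₁) * (e₂ - e₃) / (y - e₂) - e₁ = (e₂ - e₁) * (y - e₃) / (y - e₂) := by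
    have : y - e₂ ≠ 0 := hy2.ne
    field_simp
    ring
  have hpos : 0 < (e₂ - e₁) * (y - e₃) / (y - e₂) :=
    div_pos_of_neg_of_neg (mul_neg_of_neg_of_pos (by linarith) (by linarith)) hy2
  linarith

/-- The image of `(e₁, ∞)` under `Φ` is exactly the oval `(e₃, e₂)`: every `y ∈ (e₃, e₂)` is
`Φ(Φ(y))` with `Φ(y) > e₁` (`Φ` is an involution off the pole, `(e₂, 0)` being `2`-torsion).
[folklore] -/
theorem twoTorsion_image (h₃₂ : e₃ < e₂) (h₂₁ : e₂ < e₁) :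
    (fun q : Fin 1 → ℝ => fun _ : Fin 1 => e₂ + (e₂ - e₁) * (e₂ - e₃) / (q 0 - e₂)) ''
        {p : Fin 1 → ℝ | e₁ < p 0} = {p : Fin 1 → ℝ | e₃ < p 0 ∧ p 0 < e₂} := by
  -- adapted from `TwoTorsionTransfer.image_phi_eq`, `TwoTorsionTransfer.phi_phi`
  -- (Theorems/HermiteRigidityTwoTorsionTransferMove)
  have ha : (e₂ - e₁) * (e₂ - e₃) ≠ 0 :=
    (mul_neg_of_neg_of_pos (by linarith) (by linarith)).ne
  ext q
  simp only [mem_image, mem_setOf_eq]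
  constructor
  · rintro ⟨p, hp, rfl⟩
    exact twoTorsion_mem h₃₂ h₂₁ hp
  · rintro ⟨hq₃, hq₂⟩
    refine ⟨fun _ => e₂ + (e₂ - e₁) * (e₂ - e₃) / (q 0 - e₂), twoTorsion_lt h₂₁ hq₃ hq₂, ?_⟩
    funext i
    rw [Fin.fin_one_eq_zero i]
    -- the involution `Φ (Φ y) = y` off the pole
    generalize (e₂ - e₁) * (e₂ - e₃) = a at ha ⊢
    have h1 : q 0 - e₂ ≠ 0 := sub_ne_zero.mpr hq₂.ne
    have h2 : e₂ + a / (q 0 - e₂) - e₂ = a / (q 0 - e₂) := by ring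
    rw [h2]
    field_simp
    ring

/-- `Φ` is a `ℚ`-semialgebraic function on `(e₁, ∞)` for real algebraic `e₁`, `e₂`, `a`: algebraic
constants and the coordinate are `ℚ`-semialgebraic functions, and these are closed under
`+, −, /` (Tarski–Seidenberg). [folklore] -/
theorem twoTorsion_isSemialgebraicFunOn {a : ℝ} (ha₁ : IsAlgebraic ℚ e₁) (ha₂ : IsAlgebraic ℚ e₂)
    (ha : IsAlgebraic ℚ a) (h₂₁ : e₂ < e₁) :
    IsSemialgebraicFunOn ℚ {p : Fin 1 → ℝ | e₁ < p 0} (fun p => e₂ + a / (p 0 - e₂)) := by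
  have hD : IsSemialgebraic ℚ {p : Fin 1 → ℝ | e₁ < p 0} :=
    KZ.isSemialgebraic_setOf_const_lt_apply ha₁ 0
  have h0 : IsSemialgebraicFunOn ℚ {p : Fin 1 → ℝ | e₁ < p 0} (fun p => p 0) :=
    (isSemialgebraicFunOn_aeval hD (MvPolynomial.X 0)).congr fun p _ => by
      simp only [MvPolynomial.aeval_X]
  have he₂ : IsSemialgebraicFunOn ℚ {p : Fin 1 → ℝ | e₁ < p 0} (fun _ => e₂) :=
    isSemialgebraicFunOn_const_of_isAlgebraic hD ha₂
  have hc : IsSemialgebraicFunOn ℚ {p : Fin 1 → ℝ | e₁ < p 0} (fun _ => a) :=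
    isSemialgebraicFunOn_const_of_isAlgebraic hD ha
  have hden : IsSemialgebraicFunOn ℚ {p : Fin 1 → ℝ | e₁ < p 0} (fun p => p 0 - e₂) :=
    IsSemialgebraicFunOn.sub_holds h0 he₂
  have hne : ∀ p ∈ {p : Fin 1 → ℝ | e₁ < p 0}, p 0 - e₂ ≠ 0 := fun p hp => by
    have hp : e₁ < p 0 := hp
    exact (sub_pos.mpr (h₂₁.trans hp)).ne'
  exact (IsSemialgebraicFunOn.add_holds he₂ (IsSemialgebraicFunOn.div hc hden hne)).congr
    fun p _ => rfl

/-- **Invariance of `dx/y` under the `2`-torsion translation**: `f(Φ x) = Φ′(x)² · f(x)` for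
`f = 4(x − e₁)(x − e₂)(x − e₃)`, `Φ(x) = e₂ + a/(x − e₂)`, `a = (e₂ − e₁)(e₂ − e₃)`,
`Φ′(x) = −a/(x − e₂)²` (Whittaker–Watson §20.33 differentiated). [folklore] -/
theorem twoTorsion_cubic (e₁ e₂ e₃ x : ℝ) (hx : x ≠ e₂) :
    4 * (e₂ + (e₂ - e₁) * (e₂ - e₃) / (x - e₂) - e₁) *
        (e₂ + (e₂ - e₁) * (e₂ - e₃) / (x - e₂) - e₂) *
        (e₂ + (e₂ - e₁) * (e₂ - e₃) / (x - e₂) - e₃) =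
      (-((e₂ - e₁) * (e₂ - e₃)) / (x - e₂) ^ 2) ^ 2 * (4 * (x - e₁) * (x - e₂) * (x - e₃)) := by
  -- adapted from `TwoTorsionTransfer.cubic_phi` (Theorems/HermiteRigidityTwoTorsionTransferMove)
  have h : x - e₂ ≠ 0 := sub_ne_zero.mpr hx
  field_simp
  ring

/-- The Jacobian weight of the move: for `x > e₁`, `1/√f(x) = (1/√f(Φ x)) · |Φ′(x)|`
(`f > 0` on `(e₁, ∞)`, `Φ′ > 0`). [folklore] -/
theorem twoTorsion_weight {q₂ q₃ : ℚ} (h₃₂ : e₃ < e₂) (h₂₁ : e₂ < e₁)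
    (hf : ∀ x, cubic q₂ q₃ x = 4 * (x - e₁) * (x - e₂) * (x - e₃)) {x : ℝ} (hx : e₁ < x) :
    1 / Real.sqrt (cubic q₂ q₃ x) =
      1 / Real.sqrt (cubic q₂ q₃ (e₂ + (e₂ - e₁) * (e₂ - e₃) / (x - e₂))) *
        |-((e₂ - e₁) * (e₂ - e₃)) / (x - e₂) ^ 2| := by
  have hx2 : 0 < x - e₂ := by linarith
  have ha : (e₂ - e₁) * (e₂ - e₃) < 0 := mul_neg_of_neg_of_pos (by linarith) (by linarith)
  have hd : 0 < -((e₂ - e₁) * (e₂ - e₃)) / (x - e₂) ^ 2 := div_pos (by linarith) (by positivity)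
  have hfx : 0 < cubic q₂ q₃ x := by
    rw [hf]
    have h1 : 0 < x - e₁ := by linarith
    have h3 : 0 < x - e₃ := by linarith
    positivity
  rw [hf (e₂ + (e₂ - e₁) * (e₂ - e₃) / (x - e₂)), twoTorsion_cubic e₁ e₂ e₃ x (h₂₁.trans hx).ne',
    ← hf x, Real.sqrt_mul (sq_nonneg _), Real.sqrt_sq hd.le, abs_of_pos hd]
  have hs : 0 < Real.sqrt (cubic q₂ q₃ x) := Real.sqrt_pos.mpr hfx
  generalize -((e₂ - e₁) * (e₂ - e₃)) / (x - e₂) ^ 2 = d at hd ⊢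
  field_simp

/-! ### The stub -/

/-- STUB `stub_twoTorsion` of line `oval-hermite-engine`. Translation by the `2`-torsion point
`(e₂, 0)`, `Φ(x) = e₂ + (e₂ − e₁)(e₂ − e₃)/(x − e₂)`, is ONE rule-2 move
(`KZ.changeOfVariablesRel`) carrying `[(e₁,∞), 1/√f]` onto `[(e₃,e₂), 1/√f]`: `Φ` is a
`ℚ`-semialgebraic self-map of `ℝ¹` on `(e₁, ∞)` (the `eᵢ` are real algebraic), differentiable
within the domain, injective, with image exactly `(e₃, e₂)`, and `f(Φ x) = Φ′(x)² f(x)` makes the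
Jacobian weight `|Φ′|/√f(Φ)` equal to `1/√f`. Hence `[r''] − [r] ∈ KZ.relations`.
[Kontsevich–Zagier 2001, §1.2 rule (2); Whittaker–Watson 1927, §20.33] [folklore] -/
theorem stub_twoTorsion (q₂ q₃ : ℚ) (e₁ e₂ e₃ : ℝ) (h₃₂ : e₃ < e₂) (h₂₁ : e₂ < e₁)
    (ha₁ : IsAlgebraic ℚ e₁) (ha₂ : IsAlgebraic ℚ e₂) (ha₃ : IsAlgebraic ℚ e₃)
    (hf : ∀ x, cubic q₂ q₃ x = 4 * (x - e₁) * (x - e₂) * (x - e₃))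
    (r'' r : KZ.IntegralRep 1)
    (hr'' : r''.domain = {p | e₁ < p 0})
    (hri'' : EqOn r''.integrand (fun p => 1 / Real.sqrt (cubic q₂ q₃ (p 0))) r''.domain)
    (hr : r.domain = {p | e₃ < p 0 ∧ p 0 < e₂})
    (hri : EqOn r.integrand (fun p => 1 / Real.sqrt (cubic q₂ q₃ (p 0))) r.domain) :
    KZ.of r'' - KZ.of r ∈ KZ.relations := by
  refine KZ.changeOfVariablesRel_subset_relations ?_
  have ha : IsAlgebraic ℚ ((e₂ - e₁) * (e₂ - e₃)) := (ha₂.sub ha₁).mul (ha₂.sub ha₃)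
  have ha0 : (e₂ - e₁) * (e₂ - e₃) ≠ 0 :=
    (mul_neg_of_neg_of_pos (by linarith) (by linarith)).ne
  have hne : ∀ p ∈ r''.domain, p 0 ≠ e₂ := fun p hp => by
    rw [hr''] at hp
    have hp : e₁ < p 0 := hp
    exact (h₂₁.trans hp).ne'
  refine ⟨1, r'', r, fun q _ => e₂ + (e₂ - e₁) * (e₂ - e₃) / (q 0 - e₂),
    fun q => (-((e₂ - e₁) * (e₂ - e₃)) / (q 0 - e₂) ^ 2) • ContinuousLinearMap.id ℝ (Fin 1 → ℝ),
    ?_, fun p hp => (twoTorsion_hasFDerivAt _ e₂ (hne p hp)).hasFDerivWithinAt,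
    twoTorsion_injOn ha0 hne, ?_, fun p hp => ?_, rfl⟩
  · rw [hr'']
    exact IsSemialgebraicMapOn.of_forall (KZ.isSemialgebraic_setOf_const_lt_apply ha₁ 0)
      fun _ => twoTorsion_isSemialgebraicFunOn ha₁ ha₂ ha h₂₁
  · rw [hr, hr'', twoTorsion_image h₃₂ h₂₁]
  · have hp' : e₁ < p 0 := by
      rw [hr''] at hp
      exact hp
    have hΦ : (fun _ : Fin 1 => e₂ + (e₂ - e₁) * (e₂ - e₃) / (p 0 - e₂)) ∈ r.domain := by
      rw [hr]
      exact twoTorsion_mem h₃₂ h₂₁ hp'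
    simp only [hri'' hp, hri hΦ, twoTorsion_det]
    exact twoTorsion_weight h₃₂ h₂₁ hf hp'

end Summit.KontsevichZagierPeriods.HermiteRigidity.RealEllipticSectorKernel

end
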